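import Literature.Analysis.FluidPDE.LeiZhang2017AxisymmetricCriteria
import Literature.Analysis.FluidPDE.LerayHopfBoundedWindowRegular
import Literature.Analysis.FluidPDE.AxisymPoloidalPart
import HarnessLib

/-!
# Pan 2016: regularity of axisymmetric solutions under the slightly supercritical bound
# `|b| ≤ (ln|ln(r/3)|)^α / r` on the poloidal field

Topic `Literature/Analysis/FluidPDE`; one named fact (a result in print that the tree has not
proved, `def … : Prop`, D-0014) with proved corollaries, typed for the ns-blowup cell's
profile-search kill table (KILLSHEET-B §1 row R7 «log criteria … Pan 2016 = arXiv:1410.6260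
Thm 1.1 … (not typed)» before this file).

X. Pan, *Regularity of solutions to axisymmetric Navier–Stokes equations with a slightly
supercritical condition*, J. Differential Equations 260 (2016) = arXiv:1410.6260 (references to
the arXiv version, §1 pp. 1–2, §4 p. 9):

Setting (1.1)–(1.2): the axis-symmetric Navier–Stokes equations (`ν = 1`, no force),
`v = v_r e_r + v_θ e_θ + v_z e_z`, `b = v_r e_r + v_z e_z`, `Γ = r v_θ`; the slightly
supercritical assumption
(1.2) `|b| = √(v_r² + v_z²) ≤ (ln|ln(r/3)|)^α / r` if `r ≤ 1`, `≤ C/r` if `r > 1`,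
"Here `α ∈ [0, 0.028]` is any fixed constant" (coefficient ONE in front of the `ln ln` factor).

> **Theorem 1.1.** Let `(v, p)` be a suitable weak solution of the axis-symmetric Navier–Stokes
> equation (1.1) in `ℝ³ × [-1, 0)`. Assume that `b` satisfies (1.2) and `sup_{x∈ℝ³} |Γ(·, -1)| < +∞`.
> Then we have `sup_{(x,t) ∈ ℝ³×[-1,0)} |v| < +∞`.

(Abstract: "This extends the results in [Chen–Strain–Yau–Tsai], [Koch–Nadirashvili–Seregin–
Šverák], [Lei–Zhang] where regularities under critical assumptions, such as `|v| ≤ C/r`, were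
proven."  Remark 1.1: the hypothesis on `Γ(·, -1)` gives `|Γ| ≤ C` on `[-1, 0)` by the maximum
principle.  §4, Step one: "Let `M` be the maximum of `|v|` up to a fixed time `t₀`" — an a priori
bound, uniform in `t₀ < 0`, for solutions bounded before the final time.)

* `Pan2016_slightlySupercritical_regularity` — **Theorem 1.1** as a named fact.

## Rendering (a special case of the printed statement, never stronger)

The printed time interval `[-1, 0)` is translated to `[0, 1)` (final time `T = 1`; the assumption
(1.2) is NOT scale invariant, so the unit length of the interval is part of the statement — for a
solution on `[0, T)` apply the fact to the Navier–Stokes rescaling `√T v(√T x, T t)`, whose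
hypothesis is (1.2) with `r/3` replaced by `r/(3√T)` and the threshold `r ≤ 1` by `r ≤ √T`; not
formalised).  As for the sibling GLOBAL axisymmetric criteria (`Wei2016_logModulus_regularity`,
`LeiZhang2017_logModulus_regularity`, `Zhang2026_partialTypeI_regularity`) the solution class is
the classical one of the tree: a classical solution `(u, p)` of Navier–Stokes (`ν = 1`, `f = 0`) on
`[0, 1) × ℝ³` (`IsClassicalNSSolutionOn (Ico 0 1) 1 0 u p`; printed §4: `v` bounded, hence smooth,
up to every `t₀ < 0`) which is Leray–Hopf on `[0, 1)` from its datum (`IsLerayHopfOn 1 1 0 (u 0) u`)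
with the datum rapidly decaying (`HasRapidSpatialDecay (u 0)`) — such a `(u, p)` is a suitable weak
solution on `ℝ³ × (0, 1)` (smooth finite-energy solutions satisfy the local energy EQUALITY), so
this is a SUBCLASS of the printed one —, every slice `u t` axisymmetric (`IsAxisymmetric`), the
printed `sup_x |Γ(·, -1)| < ∞` as `‖swirl (u 0)‖_{L^∞} < ∞` (`Γ = swirl = r u_θ`; automatic here,
`HasRapidSpatialDecay.eLpNorm_swirl_lt_top`, kept as printed), and (1.2) verbatim with
`|b| = ‖poloidalPart (u t) x‖` (`= √(v_r² + v_z²)`, the accepted poloidal part `u - u_θ e_θ`,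
`AxisymPoloidalPart.lean`) and `r = cylRadius x`, imposed OFF the axis (`0 < r`; at `r = 0` the
printed right-hand side is not defined and Lean's junk value would read `|b| ≤ 0`), the exponent as
a real power of the positive base `ln|ln(r/3)| ≥ ln ln 3 > 0` (`r ≤ 1`), `α ∈ [0, 0.028] = [0, 7/250]`.
Conclusion verbatim: `sup_{[0,1)×ℝ³} |v| < ∞`, i.e. `∃ M, ∀ t ∈ [0, 1), ∀ x, ‖u t x‖ ≤ M`; the
continuation past `t = 1` is then PROVED (`Pan2016_slightlySupercritical_regularity.hasSmoothExtensionPast`)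
exactly as for `Zhang2026_partialTypeI_regularity`, through
`IsLerayHopfOn.isH1RegularOn_Ioc_of_ae_bound` and
`IsClassicalNSSolutionOn.hasSmoothExtensionPast_of_isH1RegularOn_Ioc`.

Not restated: Thm. 1.2 (the logarithmic modulus `|Γ| ≤ C|ln(r/3)|^{-c₀}` for weak solutions of
the drift–diffusion equation (1.3) under the zero-dimensional bound (1.6) on `E_R(b)`), Thm. 1.3
(the fundamental-solution estimate for `∂ₜ - Δ + b·∇ + (2/r)∂ᵣ`), Remark 1.2 (how `0.028` arises).

## Mathlib / tree search

Mathlib has no Navier–Stokes theory.  `lean search '1410.6260|Pan2014|Pan2016|slightlySupercritical'`: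
no declaration (2026-08-26; bib key `Pan2014` = arXiv:1410.6260 with the JDE doi).  Reused:
`IsClassicalNSSolutionOn`, `HasSmoothExtensionPast` (`ClassicalSolution.lean`); `IsLerayHopfOn`
(`LerayHopf.lean`); `HasRapidSpatialDecay` (`NSWave0.lean`); `IsAxisymmetric`, `swirl`, `cylRadius`
(`AxisymmetricEuler.lean`); `poloidalPart`, `norm_poloidalPart_le` (`AxisymPoloidalPart.lean`);
`HasRapidSpatialDecay.eLpNorm_swirl_lt_top` (`LeiZhang2017AxisymmetricCriteria.lean`);
`IsLerayHopfOn.isH1RegularOn_Ioc_of_ae_bound`,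
`IsClassicalNSSolutionOn.hasSmoothExtensionPast_of_isH1RegularOn_Ioc`
(`LerayHopfBoundedWindowRegular.lean`).  Neighbours: the critical criterion it relaxes,
`knss_bound_C_over_r` / `knss_no_axisymmetric_typeI` (`|v| ≤ C/r`, any `C`); the parallel
lnln-criteria `chenTsaiZhang2022_thm13_poloidalA` (local, suitable weak) and
`seregin2022_logSwirl_regularAtOrigin`.

## References

* X. Pan, J. Differential Equations 260 (2016), arXiv:1410.6260: Abstract, (1.1)–(1.2), Thm. 1.1,
  Remark 1.1, §4 Step one. [`Pan2014`]
* J. C. Robinson, J. L. Rodrigo, W. Sadowski, *The Three-Dimensional Navier–Stokes Equations*,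
  CUP (2016), Thm. 8.17, proof of Thm. 12.3 (continuation of bounded solutions).
  [`RobinsonRodrigoSadowski2016`]
-/

noncomputable section

open MeasureTheory Set Function Filter Topology TopologicalSpace
open scoped NNReal ENNReal

namespace Literature.Analysis.FluidPDE

/-- Local notation for physical space `ℝ³ = EuclideanSpace ℝ (Fin 3)`. -/
local notation "ℝ³" => EuclideanSpace ℝ (Fin 3)

namespace Pan2016

/-- Pan's slightly supercritical majorant (1.2) for the poloidal field near the axis:
`(ln|ln(r/3)|)^α / r` (`0 < r ≤ 1`), as a real power. [cite: Pan2014, (1.2)] -/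
def majorant (α r : ℝ) : ℝ :=
  Real.log |Real.log (r / 3)| ^ α / r

/-- The base of the power in (1.2) is positive for `0 < r ≤ 1`: `|ln(r/3)| = ln(3/r) ≥ ln 3 > 1`,
so `ln|ln(r/3)| > 0`. [cite: Pan2014, (1.2)] -/
theorem log_abs_log_pos {r : ℝ} (hr : 0 < r) (hr1 : r ≤ 1) : 0 < Real.log |Real.log (r / 3)| := by
  refine Real.log_pos ?_
  have hlt : Real.log (r / 3) < -1 := by
    have h3 : r / 3 ≤ 1 / 3 := by linarith
    have hpos : 0 < r / 3 := by positivity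
    calc Real.log (r / 3) ≤ Real.log (1 / 3) := Real.log_le_log hpos h3
      _ = -Real.log 3 := by rw [one_div, Real.log_inv]
      _ < -1 := by
        have : (1 : ℝ) < Real.log 3 := by
          rw [← Real.exp_lt_exp, Real.exp_log (by norm_num : (0 : ℝ) < 3)]
          exact Real.exp_one_lt_d9.trans (by norm_num)
        linarith
  rw [abs_of_neg (by linarith)]
  linarith

/-- Hence the majorant is positive on `0 < r ≤ 1` (for every real `α`). [cite: Pan2014, (1.2)] -/
theorem majorant_pos (α : ℝ) {r : ℝ} (hr : 0 < r) (hr1 : r ≤ 1) : 0 < majorant α r :=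
  div_pos (Real.rpow_pos_of_pos (log_abs_log_pos hr hr1) α) hr

end Pan2016

open Pan2016

/-! ### The named fact -/

/-- **Pan 2016, Theorem 1.1 (regularity under the slightly supercritical bound (1.2) on the
poloidal field).**  "Let `(v, p)` be a suitable weak solution of the axis-symmetric Navier–Stokes
equation (1.1) in `ℝ³ × [-1, 0)`. Assume that `b` satisfies (1.2) [`|b| ≤ (ln|ln(r/3)|)^α / r` for
`r ≤ 1`, `|b| ≤ C/r` for `r > 1`, `α ∈ [0, 0.028]`] and `sup_x |Γ(·, -1)| < +∞`. Then
`sup_{ℝ³×[-1,0)} |v| < +∞`" (`ν = 1`; `b = v_r e_r + v_z e_z`, `Γ = r v_θ`).  Rendered (module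
docstring) on the translated interval `[0, 1)` for a classical solution which is Leray–Hopf from a
rapidly decaying datum with axisymmetric slices, with `|b| = ‖poloidalPart (u t) x‖`, `r = cylRadius x`,
(1.2) imposed off the axis, `α ∈ [0, 7/250]`; conclusion: `v` is bounded on `[0, 1) × ℝ³`.
[cite: Pan2014, Thm. 1.1 with (1.2) (arXiv:1410.6260 §1 p. 2) and §4 Step one] -/
def Pan2016_slightlySupercritical_regularity : Prop :=
  ∀ (α C : ℝ), 0 ≤ α → α ≤ 7 / 250 → ∀ (u : ℝ → ℝ³ → ℝ³) (p : ℝ → ℝ³ → ℝ),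
    IsClassicalNSSolutionOn (Ico 0 1) 1 0 u p → IsLerayHopfOn 1 1 0 (u 0) u →
    HasRapidSpatialDecay (u 0) → (∀ t ∈ Ico (0 : ℝ) 1, IsAxisymmetric (u t)) →
    eLpNorm (swirl (u 0)) ∞ volume < ∞ →
    (∀ t ∈ Ico (0 : ℝ) 1, ∀ x : ℝ³, 0 < cylRadius x → cylRadius x ≤ 1 →
      ‖poloidalPart (u t) x‖ ≤ majorant α (cylRadius x)) →
    (∀ t ∈ Ico (0 : ℝ) 1, ∀ x : ℝ³, 1 < cylRadius x →
      ‖poloidalPart (u t) x‖ ≤ C / cylRadius x) →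
    ∃ M : ℝ, ∀ t ∈ Ico (0 : ℝ) 1, ∀ x : ℝ³, ‖u t x‖ ≤ M

/-! ### API -/

namespace Pan2016_slightlySupercritical_regularity

variable {u : ℝ → ℝ³ → ℝ³} {p : ℝ → ℝ³ → ℝ} {α C : ℝ}

/-- **Continuation form**: under the hypotheses of Thm. 1.1 (rendered on `[0, 1)`) the classical
solution extends smoothly past `t = 1`.  PROVED from the fact: boundedness on `(0, 1) × ℝ³` makes
the Leray–Hopf solution `H¹`-regular on `(0, 1]`, and an `H¹`-regular classical Leray–Hopf solution
continues. [cite: Pan2014, Thm. 1.1; RobinsonRodrigoSadowski2016, Thm. 8.17 and proof of Thm. 12.3] -/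
theorem hasSmoothExtensionPast (h : Pan2016_slightlySupercritical_regularity) (hα : 0 ≤ α)
    (hα' : α ≤ 7 / 250) (hcl : IsClassicalNSSolutionOn (Ico 0 1) 1 0 u p)
    (hLH : IsLerayHopfOn 1 1 0 (u 0) u) (hdec : HasRapidSpatialDecay (u 0))
    (hax : ∀ t ∈ Ico (0 : ℝ) 1, IsAxisymmetric (u t)) (hΓ : eLpNorm (swirl (u 0)) ∞ volume < ∞)
    (hb₁ : ∀ t ∈ Ico (0 : ℝ) 1, ∀ x : ℝ³, 0 < cylRadius x → cylRadius x ≤ 1 →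
      ‖poloidalPart (u t) x‖ ≤ majorant α (cylRadius x))
    (hb₂ : ∀ t ∈ Ico (0 : ℝ) 1, ∀ x : ℝ³, 1 < cylRadius x →
      ‖poloidalPart (u t) x‖ ≤ C / cylRadius x) :
    HasSmoothExtensionPast 1 0 u 1 := by
  obtain ⟨M, hM⟩ := h α C hα hα' u p hcl hLH hdec hax hΓ hb₁ hb₂
  have hreg : IsH1RegularOn (Ioc 0 1) u :=
    hLH.isH1RegularOn_Ioc_of_ae_bound one_pos one_pos (M := M) fun t ht =>
      ae_of_all _ fun x => hM t ⟨ht.1.le, ht.2⟩ x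
  exact hcl.hasSmoothExtensionPast_of_isH1RegularOn_Ioc one_pos one_pos hLH hreg

/-- The same without the (automatic) hypothesis `‖Γ₀‖_{L^∞} < ∞`. [cite: Pan2014, Thm. 1.1] -/
theorem hasSmoothExtensionPast' (h : Pan2016_slightlySupercritical_regularity) (hα : 0 ≤ α)
    (hα' : α ≤ 7 / 250) (hcl : IsClassicalNSSolutionOn (Ico 0 1) 1 0 u p)
    (hLH : IsLerayHopfOn 1 1 0 (u 0) u) (hdec : HasRapidSpatialDecay (u 0))
    (hax : ∀ t ∈ Ico (0 : ℝ) 1, IsAxisymmetric (u t))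
    (hb₁ : ∀ t ∈ Ico (0 : ℝ) 1, ∀ x : ℝ³, 0 < cylRadius x → cylRadius x ≤ 1 →
      ‖poloidalPart (u t) x‖ ≤ majorant α (cylRadius x))
    (hb₂ : ∀ t ∈ Ico (0 : ℝ) 1, ∀ x : ℝ³, 1 < cylRadius x →
      ‖poloidalPart (u t) x‖ ≤ C / cylRadius x) :
    HasSmoothExtensionPast 1 0 u 1 :=
  hasSmoothExtensionPast h hα hα' hcl hLH hdec hax hdec.eLpNorm_swirl_lt_top hb₁ hb₂

/-- **The hypothesis on `b` follows from the same bound on the full velocity** (`|b| ≤ |v|`,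
`norm_poloidalPart_le`): the form "`|v| ≤ C (ln|ln r|)^α / r`" of the Abstract.
[cite: Pan2014, Abstract and (1.2)] -/
theorem hasSmoothExtensionPast_of_velocity_bound (h : Pan2016_slightlySupercritical_regularity)
    (hα : 0 ≤ α) (hα' : α ≤ 7 / 250) (hcl : IsClassicalNSSolutionOn (Ico 0 1) 1 0 u p)
    (hLH : IsLerayHopfOn 1 1 0 (u 0) u) (hdec : HasRapidSpatialDecay (u 0))
    (hax : ∀ t ∈ Ico (0 : ℝ) 1, IsAxisymmetric (u t))
    (hv₁ : ∀ t ∈ Ico (0 : ℝ) 1, ∀ x : ℝ³, 0 < cylRadius x → cylRadius x ≤ 1 →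
      ‖u t x‖ ≤ majorant α (cylRadius x))
    (hv₂ : ∀ t ∈ Ico (0 : ℝ) 1, ∀ x : ℝ³, 1 < cylRadius x → ‖u t x‖ ≤ C / cylRadius x) :
    HasSmoothExtensionPast 1 0 u 1 :=
  hasSmoothExtensionPast' h hα hα' hcl hLH hdec hax
    (fun t ht x hr hr1 => (norm_poloidalPart_le (u t) x).trans (hv₁ t ht x hr hr1))
    (fun t ht x hr => (norm_poloidalPart_le (u t) x).trans (hv₂ t ht x hr))

/-- **Contrapositive, the kill-table form**: an axisymmetric classical Leray–Hopf solution on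
`[0, 1)` from a rapidly decaying datum which does NOT extend past `t = 1`, and whose poloidal field
obeys `|b| ≤ C/r` for `r > 1`, violates (1.2) near the axis: for every `α ∈ [0, 0.028]` some point
of `[0, 1) × {0 < r ≤ 1}` has `|b| > (ln|ln(r/3)|)^α / r`. [cite: Pan2014, Thm. 1.1] -/
theorem exists_poloidal_gt_of_not_hasSmoothExtensionPast
    (h : Pan2016_slightlySupercritical_regularity) (hα : 0 ≤ α) (hα' : α ≤ 7 / 250)
    (hcl : IsClassicalNSSolutionOn (Ico 0 1) 1 0 u p) (hLH : IsLerayHopfOn 1 1 0 (u 0) u)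
    (hdec : HasRapidSpatialDecay (u 0)) (hax : ∀ t ∈ Ico (0 : ℝ) 1, IsAxisymmetric (u t))
    (hb₂ : ∀ t ∈ Ico (0 : ℝ) 1, ∀ x : ℝ³, 1 < cylRadius x →
      ‖poloidalPart (u t) x‖ ≤ C / cylRadius x)
    (hmax : ¬ HasSmoothExtensionPast 1 0 u 1) :
    ∃ t ∈ Ico (0 : ℝ) 1, ∃ x : ℝ³, 0 < cylRadius x ∧ cylRadius x ≤ 1 ∧
      majorant α (cylRadius x) < ‖poloidalPart (u t) x‖ := by
  by_contra hcon
  push Not at hcon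
  exact hmax (hasSmoothExtensionPast' h hα hα' hcl hLH hdec hax
    (fun t ht x hr hr1 => hcon t ht x hr hr1) hb₂)

end Pan2016_slightlySupercritical_regularity

end Literature.Analysis.FluidPDE

end
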